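import Summits.Ventures.Crystal3D.Theorems.StickyWulffConstantGenericWallFloorSweptSteering
import Summits.Ventures.Crystal3D.Theorems.StickyWulffConstantGenericWallFloorStackWalk
import HarnessLib

/-!
# SWEPT STEERING EXISTS at every push: an adjacent capper in the mirror plane of any other menu normal
# (crux `GenericWallFloor`, stmt-Ventures-19480, line `WallLedgerG`; memo RISER-LEDGER-g8 §4, HOME/wall-p1-g8/)

HONEST FRAMING. Venture `Summits/Ventures/Crystal3D` (cell `crystal3d-full`), helper `--supports` the crux
`GenericWallFloor` of `route-Ventures-StickyWulffConstant`, REGISTERED line `WallLedgerG`, open stub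
`stub_twoSlabAdhesion`.  Structure only (census-free, inner products only); F-C1 not moved; NOT the crux, no ledger here.
Sequel of `…SweptSteering` (the explicit steering `z′ = (v + c)/‖v + c‖` selects an ADJACENT capper `c` and keeps the
incoming direction steep; an `m`-in-plane capper forces a next normal `≠ ±m`).  This file proves that the required capper
always EXISTS, for every twin push and every other plane family:

* `eq_of_two_crossing_pos_slots` — for unit menu normals `n`, `m` of a frame `F'` with `m ≠ ±n`, at most ONE `n`-positive
  slot of `F'` is `m`-crossing (two such slots `u ≠ u'` would have `F'u, F'u' ∈ {(n ± m)/(2√(2/3))}`, hence `⟪u, u'⟫ ∈ {1, 0}`,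
  against `⟪u, u'⟫ = 1/2` for distinct positive slots);
* `inner_incoming_capper` — across the twin `F' x = F x − 2⟪F x, n⟫ n`, the incoming `n`-positive slot `w` of `F` and an
  `n`-positive slot `q` of `F'` make `⟪F w, F' q⟫ = 5/6` if `q ≠ −w` (ADJACENT capper) and `= 1/3` if `q = −w` (the far one);
* **`exists_inPlane_adjacent_capper`** — hence for every other menu normal `m ≠ ±n` of `F'` there is an `n`-positive slot `c`
  of `F'` with `⟪F' c, m⟫ = 0`, `⟪F w, F' c⟫ = 5/6`, and every other positive slot `q` has `⟪F' q, F w⟫ ≤ 5/6`,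
  `⟪F' q, F' c⟫ ≤ 1/2` — exactly the hypotheses of `bestCapper_eq_of_swept_steering`;
* **`exists_swept_steering`** — so there is a UNIT steering `z′` with the incoming slot `z′`-steep (`√2/2 ≤ ⟪F w, z′⟫`, as
  `walkInv_start` / `StackSound` want) whose `bestCapper F' n z′` lies in the mirror plane of `m`;
* **`exists_steering_forcedTop_one_nrm_ne`** — in the language of `…StackWalkForcedChain`: for the bottom `⟨F, w, 0⟩` and
  first push normal `n`, some admissible steering makes the level-1 normal of the forced ray `≠ ±m`.  With `m` = the far
  interface's normal this is «the swept ray's second mirror is not across the far plane» — the census-free reason the swept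
  steep family never arrives on the `Σ9` cap (memo §4: ray `A₂ → T → R_{μ₃}T`, 0 arrivals in the exact simulation).
WHAT THIS IS NOT: no walk, no ledger, no statement beyond level 1 of the ray (deeper levels need the twin tree); F-C1 not moved.
-/

noncomputable section

namespace Summit.Ventures.Crystal3D.Theorems

open Finset
open scoped InnerProductSpace

/-! ### At most one positive slot crosses another plane family -/

/-- The opposite of a unit menu normal is a unit menu normal (local copy of `menu_neg`). -/
private theorem menu_neg_local {F' : EuclideanSpace ℝ (Fin 3) ≃ₗᵢ[ℝ] EuclideanSpace ℝ (Fin 3)} {m : EuclideanSpace ℝ (Fin 3)}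
    (hmenu : ∀ w ∈ fccSlots, ⟪F' w, m⟫_ℝ = 0 ∨ ⟪F' w, m⟫_ℝ = Real.sqrt (2 / 3) ∨ ⟪F' w, m⟫_ℝ = -Real.sqrt (2 / 3)) :
    ∀ w ∈ fccSlots, ⟪F' w, -m⟫_ℝ = 0 ∨ ⟪F' w, -m⟫_ℝ = Real.sqrt (2 / 3) ∨ ⟪F' w, -m⟫_ℝ = -Real.sqrt (2 / 3) := by
  intro w hw
  rw [inner_neg_right]
  rcases hmenu w hw with h | h | h
  · exact Or.inl (by rw [h, neg_zero])
  · exact Or.inr (Or.inr (by rw [h]))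
  · exact Or.inr (Or.inl (by rw [h, neg_neg]))

/-- An `n`-positive slot that CROSSES the plane family `m ≠ ±n` pins its image: `F' u = (n + m)/(2√(2/3))` or
`F' u = (n − m)/(2√(2/3))` (according to the sign of `⟪F' u, m⟫`). -/
theorem image_eq_of_crossing_pos_slot (F' : EuclideanSpace ℝ (Fin 3) ≃ₗᵢ[ℝ] EuclideanSpace ℝ (Fin 3))
    {n m u : EuclideanSpace ℝ (Fin 3)} (hn : ‖n‖ = 1) (hm : ‖m‖ = 1)
    (hmenun : ∀ w ∈ fccSlots, ⟪F' w, n⟫_ℝ = 0 ∨ ⟪F' w, n⟫_ℝ = Real.sqrt (2 / 3) ∨ ⟪F' w, n⟫_ℝ = -Real.sqrt (2 / 3))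
    (hmenum : ∀ w ∈ fccSlots, ⟪F' w, m⟫_ℝ = 0 ∨ ⟪F' w, m⟫_ℝ = Real.sqrt (2 / 3) ∨ ⟪F' w, m⟫_ℝ = -Real.sqrt (2 / 3))
    (hmn : m ≠ n) (hmn' : m ≠ -n) (hu : u ∈ fccSlots) (hun : ⟪F' u, n⟫_ℝ = Real.sqrt (2 / 3)) (hum : ⟪F' u, m⟫_ℝ ≠ 0) :
    (2 * Real.sqrt (2 / 3)) • F' u = n + m ∨ (2 * Real.sqrt (2 / 3)) • F' u = n - m := by
  have hc : ‖F' u‖ = 1 := by rw [LinearIsometryEquiv.norm_map, norm_eq_one_of_mem_fccSlots hu]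
  have hcn : ⟪F' u, n⟫_ℝ = Real.sqrt (2 / 3) := hun
  rcases hmenum u hu with h0 | hp | hneg
  · exact absurd h0 hum
  · -- `m` makes `F' u` positive too: `m = 2√(2/3) F'u − n`
    rcases menu_normal_eq_or_eq_twin F' hn hm hc hmenun hmenum hcn hp with h | h
    · exact absurd h hmn
    · left; rw [h]; abel
  · -- `−m` makes `F' u` positive: `−m = 2√(2/3) F'u − n`
    have hm' : ‖-m‖ = 1 := by rw [norm_neg, hm]
    have hp' : ⟪F' u, -m⟫_ℝ = Real.sqrt (2 / 3) := by rw [inner_neg_right, hneg, neg_neg]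
    rcases menu_normal_eq_or_eq_twin F' hn hm' hc hmenun (menu_neg_local hmenum) hcn hp' with h | h
    · exact absurd (neg_eq_iff_eq_neg.1 h) hmn'
    · right
      have : m = -((2 * Real.sqrt (2 / 3)) • F' u - n) := by rw [← h, neg_neg]
      rw [this]; abel

/-- **At most one `n`-positive slot crosses the plane family `m ≠ ±n`.** -/
theorem eq_of_two_crossing_pos_slots (F' : EuclideanSpace ℝ (Fin 3) ≃ₗᵢ[ℝ] EuclideanSpace ℝ (Fin 3))
    {n m u u' : EuclideanSpace ℝ (Fin 3)} (hn : ‖n‖ = 1) (hm : ‖m‖ = 1)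
    (hmenun : ∀ w ∈ fccSlots, ⟪F' w, n⟫_ℝ = 0 ∨ ⟪F' w, n⟫_ℝ = Real.sqrt (2 / 3) ∨ ⟪F' w, n⟫_ℝ = -Real.sqrt (2 / 3))
    (hmenum : ∀ w ∈ fccSlots, ⟪F' w, m⟫_ℝ = 0 ∨ ⟪F' w, m⟫_ℝ = Real.sqrt (2 / 3) ∨ ⟪F' w, m⟫_ℝ = -Real.sqrt (2 / 3))
    (hmn : m ≠ n) (hmn' : m ≠ -n)
    (hu : u ∈ fccSlots) (hun : ⟪F' u, n⟫_ℝ = Real.sqrt (2 / 3)) (hum : ⟪F' u, m⟫_ℝ ≠ 0)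
    (hu' : u' ∈ fccSlots) (hu'n : ⟪F' u', n⟫_ℝ = Real.sqrt (2 / 3)) (hu'm : ⟪F' u', m⟫_ℝ ≠ 0) : u = u' := by
  have hr : 0 < Real.sqrt (2 / 3) := Real.sqrt_pos.2 (by norm_num)
  have hnn : ⟪n, n⟫_ℝ = 1 := by rw [real_inner_self_eq_norm_sq, hn, one_pow]
  have hmm : ⟪m, m⟫_ℝ = 1 := by rw [real_inner_self_eq_norm_sq, hm, one_pow]
  have h1 := image_eq_of_crossing_pos_slot F' hn hm hmenun hmenum hmn hmn' hu hun hum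
  have h2 := image_eq_of_crossing_pos_slot F' hn hm hmenun hmenum hmn hmn' hu' hu'n hu'm
  -- the scaled images have inner product `4·(2/3)·⟪u, u'⟫`
  have hsc : ⟪(2 * Real.sqrt (2 / 3)) • F' u, (2 * Real.sqrt (2 / 3)) • F' u'⟫_ℝ = 8 / 3 * ⟪u, u'⟫_ℝ := by
    rw [real_inner_smul_left, real_inner_smul_right, LinearIsometryEquiv.inner_map_map]
    have h23 : Real.sqrt (2 / 3) * Real.sqrt (2 / 3) = 2 / 3 := Real.mul_self_sqrt (by norm_num)
    linear_combination (4 * ⟪u, u'⟫_ℝ) * h23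
  by_contra hne
  -- distinct positive slots are at inner product `1/2`
  have hhalf : ⟪u, u'⟫_ℝ = 1 / 2 :=
    inner_eq_half_of_pos_pos F' hn hmenun hu hu' hne (by rw [hun]; exact hr) (by rw [hu'n]; exact hr)
  rw [hhalf] at hsc
  rcases h1 with h1 | h1 <;> rcases h2 with h2 | h2 <;> rw [h1, h2] at hsc
  · -- both `n + m`: `‖n + m‖² = 4/3` would have to hold, but then ... compute: ⟪n+m,n+m⟫ = 2 + 2⟪n,m⟫ = 4/3 ⇒ fine?  No:
    -- equal images force `u = u'` directly.
    exact hne (F'.injective (smul_right_injective _ (by positivity : (2 * Real.sqrt (2 / 3)) ≠ 0) (h1.trans h2.symm)))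
  · rw [inner_add_left, inner_sub_right, inner_sub_right, hnn, hmm, real_inner_comm n m] at hsc
    linarith
  · rw [inner_sub_left, inner_add_right, inner_add_right, hnn, hmm, real_inner_comm n m] at hsc
    linarith
  · exact hne (F'.injective (smul_right_injective _ (by positivity : (2 * Real.sqrt (2 / 3)) ≠ 0) (h1.trans h2.symm)))

/-! ### The incoming slot against the cappers -/

/-- **`⟪F w, F' q⟫ = ⟪w, q⟫ + 4/3`** across the twin `F' x = F x − 2⟪F x, n⟫ n`, for the incoming `n`-positive slot `w`
of `F` and an `n`-positive slot `q` of `F'`. -/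
theorem inner_incoming_capper_eq (F F' : EuclideanSpace ℝ (Fin 3) ≃ₗᵢ[ℝ] EuclideanSpace ℝ (Fin 3))
    {n w q : EuclideanSpace ℝ (Fin 3)} (hn : ‖n‖ = 1) (hF' : ∀ x, F' x = F x - (2 * ⟪F x, n⟫_ℝ) • n)
    (hwn : ⟪F w, n⟫_ℝ = Real.sqrt (2 / 3)) (hqn : ⟪F' q, n⟫_ℝ = Real.sqrt (2 / 3)) :
    ⟪F w, F' q⟫_ℝ = ⟪w, q⟫_ℝ + 4 / 3 := by
  have hflip := inner_twin_eq_neg F F' hn hF' q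
  have hFq : ⟪F q, n⟫_ℝ = -Real.sqrt (2 / 3) := by linarith
  have h23 : Real.sqrt (2 / 3) * Real.sqrt (2 / 3) = 2 / 3 := Real.mul_self_sqrt (by norm_num)
  rw [hF' q, inner_sub_right, real_inner_smul_right, LinearIsometryEquiv.inner_map_map, hwn, hFq]
  nlinarith [h23]

/-- **Adjacent or far.**  With `w`, `q` as above (both slots): `⟪F w, F' q⟫ = 5/6` if `q ≠ −w`, and `≤ 5/6` always. -/
theorem inner_incoming_capper (F F' : EuclideanSpace ℝ (Fin 3) ≃ₗᵢ[ℝ] EuclideanSpace ℝ (Fin 3))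
    {n w q : EuclideanSpace ℝ (Fin 3)} (hn : ‖n‖ = 1)
    (hmenu : ∀ v ∈ fccSlots, ⟪F v, n⟫_ℝ = 0 ∨ ⟪F v, n⟫_ℝ = Real.sqrt (2 / 3) ∨ ⟪F v, n⟫_ℝ = -Real.sqrt (2 / 3))
    (hF' : ∀ x, F' x = F x - (2 * ⟪F x, n⟫_ℝ) • n)
    (hw : w ∈ fccSlots) (hwn : ⟪F w, n⟫_ℝ = Real.sqrt (2 / 3)) (hq : q ∈ fccSlots) (hqn : ⟪F' q, n⟫_ℝ = Real.sqrt (2 / 3)) :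
    ⟪F w, F' q⟫_ℝ ≤ 5 / 6 ∧ (q ≠ -w → ⟪F w, F' q⟫_ℝ = 5 / 6) := by
  have hr : 0 < Real.sqrt (2 / 3) := Real.sqrt_pos.2 (by norm_num)
  have heq := inner_incoming_capper_eq F F' hn hF' hwn hqn
  have hflip := inner_twin_eq_neg F F' hn hF' q
  -- `−q` is an `n`-positive slot of `F`
  have hnegq : -q ∈ fccSlots := neg_mem_fccSlots hq
  have hposw : 0 < ⟪F w, n⟫_ℝ := by rw [hwn]; exact hr
  have hposq : 0 < ⟪F (-q), n⟫_ℝ := by rw [map_neg, inner_neg_left]; linarith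
  by_cases hqw : q = -w
  · refine ⟨?_, fun h => absurd hqw h⟩
    have : ⟪w, q⟫_ℝ = -1 := by
      rw [hqw, inner_neg_right, real_inner_self_eq_norm_sq, norm_eq_one_of_mem_fccSlots hw]; norm_num
    rw [heq, this]; norm_num
  · have hne : w ≠ -q := fun h => hqw (by rw [h, neg_neg])
    have hhalf : ⟪w, -q⟫_ℝ = 1 / 2 := inner_eq_half_of_pos_pos F hn hmenu hw hnegq hne hposw hposq
    have : ⟪w, q⟫_ℝ = -(1 / 2) := by rw [inner_neg_right] at hhalf; linarith
    rw [heq, this]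
    refine ⟨by norm_num, fun _ => by norm_num⟩

/-! ### Existence of the in-plane adjacent capper and of the swept steering -/

/-- **An `m`-in-plane ADJACENT capper exists.**  `F` a frame with unit menu normal `n`, `w` an `n`-positive slot (the
incoming direction), `F'` the twin frame across `n`, `m ≠ ±n` another unit menu normal of `F'`.  Then some `n`-positive
slot `c` of `F'` is `m`-in-plane and adjacent to `w`, and the other positive slots satisfy the comparison hypotheses of
`bestCapper_eq_of_swept_steering`. -/
theorem exists_inPlane_adjacent_capper (F F' : EuclideanSpace ℝ (Fin 3) ≃ₗᵢ[ℝ] EuclideanSpace ℝ (Fin 3))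
    {n m w : EuclideanSpace ℝ (Fin 3)} (hn : ‖n‖ = 1) (hm : ‖m‖ = 1)
    (hmenu : ∀ v ∈ fccSlots, ⟪F v, n⟫_ℝ = 0 ∨ ⟪F v, n⟫_ℝ = Real.sqrt (2 / 3) ∨ ⟪F v, n⟫_ℝ = -Real.sqrt (2 / 3))
    (hF' : ∀ x, F' x = F x - (2 * ⟪F x, n⟫_ℝ) • n)
    (hmenum : ∀ v ∈ fccSlots, ⟪F' v, m⟫_ℝ = 0 ∨ ⟪F' v, m⟫_ℝ = Real.sqrt (2 / 3) ∨ ⟪F' v, m⟫_ℝ = -Real.sqrt (2 / 3))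
    (hmn : m ≠ n) (hmn' : m ≠ -n) (hw : w ∈ fccSlots) (hwn : ⟪F w, n⟫_ℝ = Real.sqrt (2 / 3)) :
    ∃ c ∈ fccSlots, 0 < ⟪F' c, n⟫_ℝ ∧ ⟪F' c, m⟫_ℝ = 0 ∧ ⟪F w, F' c⟫_ℝ = 5 / 6 ∧
      ∀ q ∈ fccSlots, 0 < ⟪F' q, n⟫_ℝ → q ≠ c → ⟪F' q, F w⟫_ℝ ≤ 5 / 6 ∧ ⟪F' q, F' c⟫_ℝ ≤ 1 / 2 := by
  have hr : 0 < Real.sqrt (2 / 3) := Real.sqrt_pos.2 (by norm_num)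
  have hmenu' : ∀ v ∈ fccSlots, ⟪F' v, n⟫_ℝ = 0 ∨ ⟪F' v, n⟫_ℝ = Real.sqrt (2 / 3) ∨ ⟪F' v, n⟫_ℝ = -Real.sqrt (2 / 3) :=
    menu_reflect F F' hn hmenu hF'
  -- the three positive slots of `F'`
  obtain ⟨u₁, hu₁, u₂, hu₂, u₃, hu₃, hn1, hn2, hn3, h12, h13, h23, -, hexh⟩ := exists_far_frame F' hn hmenu'
  have hval : ∀ {q}, q ∈ fccSlots → 0 < ⟪F' q, n⟫_ℝ → ⟪F' q, n⟫_ℝ = Real.sqrt (2 / 3) := by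
    intro q hq hpos
    rcases hmenu' q hq with h | h | h
    · rw [h] at hpos; exact absurd hpos (lt_irrefl 0)
    · exact h
    · rw [h] at hpos; linarith
  have hd12 : u₁ ≠ u₂ := by
    intro h; rw [h, real_inner_self_eq_norm_sq, norm_eq_one_of_mem_fccSlots hu₂] at h12; norm_num at h12
  have hd13 : u₁ ≠ u₃ := by
    intro h; rw [h, real_inner_self_eq_norm_sq, norm_eq_one_of_mem_fccSlots hu₃] at h13; norm_num at h13
  have hd23 : u₂ ≠ u₃ := by
    intro h; rw [h, real_inner_self_eq_norm_sq, norm_eq_one_of_mem_fccSlots hu₃] at h23; norm_num at h23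
  -- the comparison facts for any chosen positive slot `c`
  have hothers : ∀ {c}, c ∈ fccSlots → 0 < ⟪F' c, n⟫_ℝ → ∀ q ∈ fccSlots, 0 < ⟪F' q, n⟫_ℝ → q ≠ c →
      ⟪F' q, F w⟫_ℝ ≤ 5 / 6 ∧ ⟪F' q, F' c⟫_ℝ ≤ 1 / 2 := by
    intro c hc hcpos q hq hqpos hqc
    refine ⟨?_, ?_⟩
    · rw [real_inner_comm]; exact (inner_incoming_capper F F' hn hmenu hF' hw hwn hq (hval hq hqpos)).1
    · rw [LinearIsometryEquiv.inner_map_map, inner_eq_half_of_pos_pos F' hn hmenu' hq hc hqc hqpos hcpos]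
  -- pick among `u₁, u₂, u₃` one that is `m`-in-plane and `≠ −w`: at most one is `m`-crossing, at most one is `−w`
  have hcross1 : ∀ {a b}, a ∈ fccSlots → b ∈ fccSlots → ⟪F' a, n⟫_ℝ = Real.sqrt (2 / 3) → ⟪F' b, n⟫_ℝ = Real.sqrt (2 / 3) →
      a ≠ b → ⟪F' a, m⟫_ℝ ≠ 0 → ⟪F' b, m⟫_ℝ = 0 := by
    intro a b ha hb han hbn hab ham
    by_contra hbm
    exact hab (eq_of_two_crossing_pos_slots F' hn hm hmenu' hmenum hmn hmn' ha han ham hb hbn hbm)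
  have good : ∀ {c}, c ∈ fccSlots → ⟪F' c, n⟫_ℝ = Real.sqrt (2 / 3) → ⟪F' c, m⟫_ℝ = 0 → c ≠ -w →
      ∃ c ∈ fccSlots, 0 < ⟪F' c, n⟫_ℝ ∧ ⟪F' c, m⟫_ℝ = 0 ∧ ⟪F w, F' c⟫_ℝ = 5 / 6 ∧
        ∀ q ∈ fccSlots, 0 < ⟪F' q, n⟫_ℝ → q ≠ c → ⟪F' q, F w⟫_ℝ ≤ 5 / 6 ∧ ⟪F' q, F' c⟫_ℝ ≤ 1 / 2 := by
    intro c hc hcn hcm hcw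
    have hcpos : 0 < ⟪F' c, n⟫_ℝ := by rw [hcn]; exact hr
    exact ⟨c, hc, hcpos, hcm, (inner_incoming_capper F F' hn hmenu hF' hw hwn hc hcn).2 hcw, hothers hc hcpos⟩
  by_cases h1m : ⟪F' u₁, m⟫_ℝ = 0
  · by_cases h1w : u₁ = -w
    · -- `u₁ = −w`: then `u₂ ≠ −w`; use `u₂` if in-plane, else `u₃` (in-plane by `hcross1`) and `u₃ ≠ −w`
      by_cases h2m : ⟪F' u₂, m⟫_ℝ = 0
      · exact good hu₂ hn2 h2m (fun h => hd12 (h1w.trans h.symm))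
      · exact good hu₃ hn3 (hcross1 hu₂ hu₃ hn2 hn3 hd23 h2m) (fun h => hd13 (h1w.trans h.symm))
    · exact good hu₁ hn1 h1m h1w
  · -- `u₁` crosses `m`: both `u₂`, `u₃` are in-plane; one of them is `≠ −w`
    have h2m := hcross1 hu₁ hu₂ hn1 hn2 hd12 h1m
    have h3m := hcross1 hu₁ hu₃ hn1 hn3 hd13 h1m
    by_cases h2w : u₂ = -w
    · exact good hu₃ hn3 h3m (fun h => hd23 (h2w.trans h.symm))
    · exact good hu₂ hn2 h2m h2w

/-- **The swept steering exists.**  In the setting of `exists_inPlane_adjacent_capper` there is a unit steering vector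
`z′` for which the incoming slot is steep (`√2/2 ≤ ⟪F w, z′⟫`) and `bestCapper F' n z′` is an `n`-positive slot lying
in the mirror plane of `m`. -/
theorem exists_swept_steering (F F' : EuclideanSpace ℝ (Fin 3) ≃ₗᵢ[ℝ] EuclideanSpace ℝ (Fin 3))
    {n m w : EuclideanSpace ℝ (Fin 3)} (hn : ‖n‖ = 1) (hm : ‖m‖ = 1)
    (hmenu : ∀ v ∈ fccSlots, ⟪F v, n⟫_ℝ = 0 ∨ ⟪F v, n⟫_ℝ = Real.sqrt (2 / 3) ∨ ⟪F v, n⟫_ℝ = -Real.sqrt (2 / 3))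
    (hF' : ∀ x, F' x = F x - (2 * ⟪F x, n⟫_ℝ) • n)
    (hmenum : ∀ v ∈ fccSlots, ⟪F' v, m⟫_ℝ = 0 ∨ ⟪F' v, m⟫_ℝ = Real.sqrt (2 / 3) ∨ ⟪F' v, m⟫_ℝ = -Real.sqrt (2 / 3))
    (hmn : m ≠ n) (hmn' : m ≠ -n) (hw : w ∈ fccSlots) (hwn : ⟪F w, n⟫_ℝ = Real.sqrt (2 / 3)) :
    ∃ z' : EuclideanSpace ℝ (Fin 3), ‖z'‖ = 1 ∧ Real.sqrt 2 / 2 ≤ ⟪F w, z'⟫_ℝ ∧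
      bestCapper F' n z' ∈ fccSlots ∧ 0 < ⟪F' (bestCapper F' n z'), n⟫_ℝ ∧ ⟪F' (bestCapper F' n z'), m⟫_ℝ = 0 := by
  obtain ⟨c, hc, hcpos, hcm, hwc, hothers⟩ := exists_inPlane_adjacent_capper F F' hn hm hmenu hF' hmenum hmn hmn' hw hwn
  have hFw : ‖F w‖ = 1 := by rw [LinearIsometryEquiv.norm_map, norm_eq_one_of_mem_fccSlots hw]
  have hFc : ‖F' c‖ = 1 := by rw [LinearIsometryEquiv.norm_map, norm_eq_one_of_mem_fccSlots hc]
  refine ⟨(‖F w + F' c‖⁻¹ : ℝ) • (F w + F' c), norm_swept_steering hFw hFc hwc,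
    sqrt_two_div_two_le_inner_swept_steering hFw hFc hwc, ?_⟩
  have hsel := bestCapper_eq_of_swept_steering F' n hFw hc hcpos hwc hothers
  rw [hsel]
  exact ⟨hc, hcpos, hcm⟩

/-- **Level one of the swept ray avoids the plane family `m`.**  For the bottom entry `⟨F, w, 0⟩` and the first push
normal `n` (unit menu normal of `F` with `⟪F w, n⟫ = √(2/3)`), and any unit menu normal `m ≠ ±n` of the twin frame
`twinFrame F n`: some unit steering `z′`, for which `w` is steep, makes the level-`1` entry normal of the forced ray
`forcedTop z′ ⟨F, w, 0⟩ n ·` different from `m` and from `−m`. -/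
theorem exists_steering_forcedTop_one_nrm_ne (F : EuclideanSpace ℝ (Fin 3) ≃ₗᵢ[ℝ] EuclideanSpace ℝ (Fin 3))
    {n m w : EuclideanSpace ℝ (Fin 3)} (hn : ‖n‖ = 1) (hm : ‖m‖ = 1)
    (hmenu : ∀ v ∈ fccSlots, ⟪F v, n⟫_ℝ = 0 ∨ ⟪F v, n⟫_ℝ = Real.sqrt (2 / 3) ∨ ⟪F v, n⟫_ℝ = -Real.sqrt (2 / 3))
    (hmenum : ∀ v ∈ fccSlots, ⟪twinFrame F n v, m⟫_ℝ = 0 ∨ ⟪twinFrame F n v, m⟫_ℝ = Real.sqrt (2 / 3) ∨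
      ⟪twinFrame F n v, m⟫_ℝ = -Real.sqrt (2 / 3))
    (hmn : m ≠ n) (hmn' : m ≠ -n) (hw : w ∈ fccSlots) (hwn : ⟪F w, n⟫_ℝ = Real.sqrt (2 / 3)) :
    ∃ z' : EuclideanSpace ℝ (Fin 3), ‖z'‖ = 1 ∧ Real.sqrt 2 / 2 ≤ ⟪F w, z'⟫_ℝ ∧
      (forcedTop z' ⟨F, w, 0⟩ n 1).nrm ≠ m ∧ (forcedTop z' ⟨F, w, 0⟩ n 1).nrm ≠ -m := by
  have hF' : ∀ x, twinFrame F n x = F x - (2 * ⟪F x, n⟫_ℝ) • n := fun x => twinFrame_apply F hn x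
  obtain ⟨z', hz', hsteep, hslot, hpos, hinpl⟩ :=
    exists_swept_steering F (twinFrame F n) hn hm hmenu hF' hmenum hmn hmn' hw hwn
  refine ⟨z', hz', hsteep, ?_⟩
  -- level `0` of the ray is the push entry `⟨twinFrame F n, bestCapper (twinFrame F n) n z′, n⟩`
  have h0f : (forcedTop z' ⟨F, w, 0⟩ n 0).frame = twinFrame F n := rfl
  have h0d : (forcedTop z' ⟨F, w, 0⟩ n 0).dir = bestCapper (twinFrame F n) n z' := rfl
  have hmenu' := menu_reflect F (twinFrame F n) hn hmenu hF'
  have hval : ⟪twinFrame F n (bestCapper (twinFrame F n) n z'), n⟫_ℝ = Real.sqrt (2 / 3) := by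
    rcases hmenu' _ hslot with h | h | h
    · rw [h] at hpos; exact absurd hpos (lt_irrefl 0)
    · exact h
    · rw [h] at hpos; have := Real.sqrt_pos.2 (by norm_num : (0 : ℝ) < 2 / 3); linarith
  exact forcedTop_one_nrm_ne z' ⟨F, w, 0⟩ n m (by rw [h0d]; exact hslot) (by rw [h0f, h0d]; exact hval)
    (by rw [h0f, h0d]; exact hinpl)

end Summit.Ventures.Crystal3D.Theorems

end
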